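import Literature.Probability.RandomPlanarGeometry.RestrictionMapProofs
import Literature.Probability.RandomPlanarGeometry.RestrictionCovariance
import HarnessLib

/-!
# Monotonicity of `Φ'_A(0)` in the hull: `A' ⊆ A ⇒ A = B · A'` and `Φ'_A(0) ≤ Φ'_{A'}(0)` ([LSW] §2)

G. F. Lawler, O. Schramm, W. Werner, *Conformal restriction: the chordal case*, J. Amer. Math.
Soc. **16** (2003) 917–955, arXiv:math/0209343 (**[LSW]**), §2 pp. 7–8. For `*`-hulls `A' ⊆ A`
the smaller hull divides the larger one in the semigroup `𝒬*`: with
`B := cl Φ_{A'}((A ∖ A') ∩ ℍ)` one has `ℍ ∖ B = Φ_{A'}(ℍ ∖ A)`, `B ∈ 𝒬*` and `A = B · A'`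
(`Φ_A = Φ_B ∘ Φ_{A'}`), so that by the chain rule and (2.4)
`Φ'_A(0) = Φ'_B(0) Φ'_{A'}(0) ≤ Φ'_{A'}(0)` — the monotonicity behind "the increasing sequence
`Φ'_{A_n}(0)`" of [LSW] Lemma 2.1 (p. 8) and behind Lemma 3.5. Everything here is PROVED, from the
discharged facts of `RestrictionMapProofs` (existence/uniqueness of `Φ_A`, `Φ'_A(0) ∈ (0, 1]`) and
the product calculus of `RestrictionSemigroup`:

* `Literature.Probability.RandomPlanarGeometry.IsStarHull.exists_isHullProduct_of_subset` — `A' ⊆ A ⇒ ∃ B ∈ 𝒬*, A = B · A'`;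
* `Literature.Probability.RandomPlanarGeometry.HasRestrictionDeriv.exists_eq_mul_of_subset` — `Φ'_A(0) = d_B Φ'_{A'}(0)` with `d_B ∈ (0, 1]`;
* `Literature.Probability.RandomPlanarGeometry.HasRestrictionDeriv.le_of_subset` — `Φ'_A(0) ≤ Φ'_{A'}(0)`.
-/

noncomputable section

open Set Filter Topology Metric Bornology Complex
open UpperHalfPlane (upperHalfPlaneSet isOpen_upperHalfPlaneSet)

namespace Literature.Probability.RandomPlanarGeometry

variable {A A' : Set ℂ}

/-! ### The quotient hull `B = cl Φ_{A'}((A ∖ A') ∩ ℍ)` and bounds for `Φ_{A'}` -/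

section QuotientDefs

variable {Φ' : ConformalEquiv (upperHalfPlaneSet \ A') upperHalfPlaneSet}

/-- The quotient hull `B = cl Φ_{A'}((A ∖ A') ∩ ℍ)` of `A' ⊆ A`. [cite: LawlerSchrammWerner2003Restriction, §2 p. 8 (Semigroups)] -/
def quotientHull (A A' : Set ℂ) (Φ' : ConformalEquiv (upperHalfPlaneSet \ A') upperHalfPlaneSet) :
    Set ℂ :=
  closure (Φ' '' ((A \ A') ∩ upperHalfPlaneSet))

/-- `Φ_{A'}` is bounded on bounded subsets of `ℍ ∖ A'` (its inverse tends to `∞` at `∞`). [folklore] -/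
theorem exists_forall_norm_apply_le_of_tendsto_symm_cocompact
    (hinf : Tendsto Φ'.symm (cocompact ℂ ⊓ 𝓟 upperHalfPlaneSet) (cocompact ℂ)) (R : ℝ) :
    ∃ M : ℝ, ∀ z ∈ upperHalfPlaneSet \ A', ‖z‖ ≤ R → ‖Φ' z‖ ≤ M := by
  rw [← cobounded_eq_cocompact (α := ℂ)] at hinf
  have hev := (Filter.hasBasis_cobounded_norm.inf_principal _).tendsto_iff
    Filter.hasBasis_cobounded_norm |>.1 hinf (R + 1) trivial
  obtain ⟨M, -, hM⟩ := hev
  refine ⟨M, fun z hz hzR ↦ ?_⟩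
  by_contra hlt
  push Not at hlt
  have hmem : Φ' z ∈ {x : ℂ | M ≤ ‖x‖} ∩ upperHalfPlaneSet := ⟨hlt.le, Φ'.mapsTo hz⟩
  have := hM (Φ' z) hmem
  simp only [mem_setOf_eq, Φ'.symm_apply_apply hz] at this
  linarith

/-- `Φ_{A'}` is bounded away from `0` away from `0` (its inverse tends to `0` at `0`). [folklore] -/
theorem exists_forall_le_norm_apply_of_tendsto_symm_nhds (h0 : Tendsto Φ'.symm (𝓝[upperHalfPlaneSet] 0) (𝓝 0))
    {ρ : ℝ} (hρ : 0 < ρ) :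
    ∃ c > 0, ∀ z ∈ upperHalfPlaneSet \ A', ρ ≤ ‖z‖ → c ≤ ‖Φ' z‖ := by
  have hev : ∀ᶠ w in 𝓝[upperHalfPlaneSet] (0 : ℂ), ‖Φ'.symm w‖ < ρ := by
    have := h0.eventually (Metric.ball_mem_nhds (0 : ℂ) hρ)
    filter_upwards [this] with w hw
    simpa using hw
  obtain ⟨c, hc, hball⟩ := Metric.eventually_nhds_iff.1 (eventually_nhdsWithin_iff.1 hev)
  refine ⟨c, hc, fun z hz hzρ ↦ ?_⟩
  by_contra hlt
  push Not at hlt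
  have h1 : dist (Φ' z) 0 < c := by rwa [dist_zero_right]
  have := hball h1 (Φ'.mapsTo hz)
  rw [Φ'.symm_apply_apply hz] at this
  linarith

end QuotientDefs

namespace IsStarHull

/-! ### The quotient hull `B = cl Φ_{A'}((A ∖ A') ∩ ℍ)` -/

section Quotient

variable {Φ' : ConformalEquiv (upperHalfPlaneSet \ A') upperHalfPlaneSet}

/-- The relatively closed set `Φ_{A'}((A ∖ A') ∩ ℍ)` is the trace of its closure on `ℍ`. [folklore] -/
theorem quotientHull_inter (hA : IsStarHull A) (A' : Set ℂ)
    (Φ' : ConformalEquiv (upperHalfPlaneSet \ A') upperHalfPlaneSet) :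
    quotientHull A A' Φ' ∩ upperHalfPlaneSet = Φ' '' ((A \ A') ∩ upperHalfPlaneSet) := by
  refine Subset.antisymm ?_ fun w hw ↦ ⟨subset_closure hw, ?_⟩
  · rintro w ⟨hwcl, hwH⟩
    -- `w` is a limit of `Φ' z_n`, `z_n ∈ (A ∖ A') ∩ ℍ`; continuity of `Φ'⁻¹` at `w ∈ ℍ`
    rw [quotientHull, mem_closure_iff_seq_limit] at hwcl
    obtain ⟨u, hu, hulim⟩ := hwcl
    choose z hz hzu using hu
    have hzU : ∀ n, z n ∈ upperHalfPlaneSet \ A' := fun n ↦ ⟨(hz n).2, (hz n).1.2⟩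
    have hsymm : ∀ n, Φ'.symm (u n) = z n := fun n ↦ by rw [← hzu n, Φ'.symm_apply_apply (hzU n)]
    have hcont : ContinuousAt Φ'.symm w :=
      (Φ'.symm.differentiableOn_coe.differentiableAt (isOpen_upperHalfPlaneSet.mem_nhds hwH)).continuousAt
    have hlim : Tendsto z atTop (𝓝 (Φ'.symm w)) := by
      have := hcont.tendsto.comp hulim
      exact this.congr fun n ↦ hsymm n
    have hzA : Φ'.symm w ∈ A := hA.isBoundedHull.isClosed.mem_of_tendsto hlim (Eventually.of_forall fun n ↦ (hz n).1.1)
    have hzU' : Φ'.symm w ∈ upperHalfPlaneSet \ A' := Φ'.symm_mapsTo hwH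
    exact ⟨Φ'.symm w, ⟨⟨hzA, hzU'.2⟩, hzU'.1⟩, Φ'.apply_symm_apply hwH⟩
  · obtain ⟨z, hz, rfl⟩ := hw
    exact Φ'.mapsTo ⟨hz.2, hz.1.2⟩

/-- **`ℍ ∖ B = Φ_{A'}(ℍ ∖ A)`.** [folklore] -/
theorem diff_quotientHull (hA : IsStarHull A) (hsub : A' ⊆ A) :
    upperHalfPlaneSet \ quotientHull A A' Φ' = Φ' '' (upperHalfPlaneSet \ A) := by
  ext w
  constructor
  · rintro ⟨hwH, hwB⟩
    have hz := Φ'.symm_mapsTo hwH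
    refine ⟨Φ'.symm w, ⟨hz.1, fun hzA ↦ hwB (subset_closure ?_)⟩, Φ'.apply_symm_apply hwH⟩
    exact ⟨Φ'.symm w, ⟨⟨hzA, hz.2⟩, hz.1⟩, Φ'.apply_symm_apply hwH⟩
  · rintro ⟨z, hz, rfl⟩
    have hzU : z ∈ upperHalfPlaneSet \ A' := ⟨hz.1, fun h ↦ hz.2 (hsub h)⟩
    refine ⟨Φ'.mapsTo hzU, fun hwB ↦ ?_⟩
    have : Φ' z ∈ quotientHull A A' Φ' ∩ upperHalfPlaneSet := ⟨hwB, Φ'.mapsTo hzU⟩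
    rw [quotientHull_inter hA A' Φ'] at this
    obtain ⟨z', hz', heq⟩ := this
    have := Φ'.injOn ⟨hz'.2, hz'.1.2⟩ hzU heq
    exact hz.2 (this ▸ hz'.1.1)

/-- `ℍ ∖ A = {z ∈ ℍ ∖ A' : Φ_{A'}(z) ∉ B}`, the defining identity of `A = B · A'`. [folklore] -/
theorem diff_eq_setOf_quotientHull (hA : IsStarHull A) (hsub : A' ⊆ A) :
    upperHalfPlaneSet \ A = {z | z ∈ upperHalfPlaneSet \ A' ∧ Φ' z ∉ quotientHull A A' Φ'} := by
  ext z
  constructor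
  · intro hz
    have hzU : z ∈ upperHalfPlaneSet \ A' := ⟨hz.1, fun h ↦ hz.2 (hsub h)⟩
    have : Φ' z ∈ upperHalfPlaneSet \ quotientHull A A' Φ' := by
      rw [hA.diff_quotientHull hsub]; exact ⟨z, hz, rfl⟩
    exact ⟨hzU, this.2⟩
  · rintro ⟨hzU, hzB⟩
    refine ⟨hzU.1, fun hzA ↦ hzB (subset_closure ⟨z, ⟨⟨hzA, hzU.2⟩, hzU.1⟩, rfl⟩)⟩

/-- **The quotient hull is a `*`-hull.** Bounded (`Φ_{A'}` is bounded on `A`), the closure of its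
part in `ℍ`, with simply connected complement `Φ_{A'}(ℍ ∖ A)`, and missing `0` (`Φ_{A'}` is
bounded below away from `0`). [cite: LawlerSchrammWerner2003Restriction, §2 p. 8 (Semigroups)] -/
theorem isStarHull_quotientHull (hA : IsStarHull A) (hsub : A' ⊆ A)
    (h0 : Tendsto Φ'.symm (𝓝[upperHalfPlaneSet] 0) (𝓝 0))
    (hinf : Tendsto Φ'.symm (cocompact ℂ ⊓ 𝓟 upperHalfPlaneSet) (cocompact ℂ)) :
    IsStarHull (quotientHull A A' Φ') := by
  have hUo : IsOpen (upperHalfPlaneSet \ A) := isOpen_upperHalfPlaneSet.sdiff hA.isBoundedHull.isClosed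
  refine ⟨⟨?_, ?_, ?_⟩, ?_⟩
  · -- bounded
    obtain ⟨R, hR⟩ := hA.isBoundedHull.1.subset_closedBall 0
    obtain ⟨M, hM⟩ := exists_forall_norm_apply_le_of_tendsto_symm_cocompact hinf R
    refine (isBounded_iff_forall_norm_le.2 ⟨M, ?_⟩).closure
    rintro _ ⟨z, hz, rfl⟩
    exact hM z ⟨hz.2, hz.1.2⟩ (mem_closedBall_zero_iff.1 (hR hz.1.1))
  · -- closure of its part in `ℍ`
    rw [quotientHull_inter hA A' Φ', quotientHull]
  · -- simply connected complement
    rw [hA.diff_quotientHull hsub]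
    have hsubU : upperHalfPlaneSet \ A ⊆ upperHalfPlaneSet \ A' := fun z hz ↦ ⟨hz.1, fun h ↦ hz.2 (hsub h)⟩
    set φ : ConformalEquiv (upperHalfPlaneSet \ A) (Φ' '' (upperHalfPlaneSet \ A)) :=
      Φ'.restr _ _ hsubU (by rintro _ ⟨z, hz, rfl⟩; exact Φ'.mapsTo (hsubU hz))
        (mapsTo_image _ _) (by
          rintro _ ⟨z, hz, rfl⟩
          rw [Φ'.symm_apply_apply (hsubU hz)]
          exact hz)
    exact φ.isSimplyConnected_iff.1 hA.1.2.2
  · -- `0 ∉ B`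
    obtain ⟨ρ, hρ, hρA⟩ : ∃ ρ > 0, ∀ z ∈ A, ρ ≤ ‖z‖ := by
      have h0A : (0 : ℂ) ∉ A := hA.zero_notMem
      obtain ⟨ρ, hρ, hball⟩ := Metric.isOpen_iff.1 hA.isBoundedHull.isClosed.isOpen_compl 0 h0A
      exact ⟨ρ, hρ, fun z hz ↦ not_lt.1 fun hlt ↦ hball (mem_ball_zero_iff.2 hlt) hz⟩
    obtain ⟨c, hc, hcΦ⟩ := exists_forall_le_norm_apply_of_tendsto_symm_nhds h0 hρ
    intro h0B
    have hcl : quotientHull A A' Φ' ⊆ {w : ℂ | c ≤ ‖w‖} := by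
      refine closure_minimal ?_ (isClosed_le continuous_const continuous_norm)
      rintro _ ⟨z, hz, rfl⟩
      exact hcΦ z ⟨hz.2, hz.1.2⟩ (hρA z hz.1.1)
    have := hcl h0B
    simp only [mem_setOf_eq, norm_zero] at this
    linarith

end Quotient

/-! ### `A' ⊆ A ⇒ A = B · A'` -/

/-- **A sub-hull divides**: for `*`-hulls `A' ⊆ A` there is a `*`-hull `B` (the quotient hull
`cl Φ_{A'}((A ∖ A') ∩ ℍ)`) with `A = B · A'`, i.e. `Φ_A = Φ_B ∘ Φ_{A'}`.
[cite: LawlerSchrammWerner2003Restriction, §2 p. 8 (Semigroups)] -/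
theorem exists_isHullProduct_of_subset (hA : IsStarHull A) (hA' : IsStarHull A') (hsub : A' ⊆ A) :
    ∃ B : Set ℂ, IsStarHull B ∧ RestrictionConfig.IsHullProduct B A' A := by
  obtain ⟨Φ', hΦ', h0, hinf, -⟩ := hA'.exists_restrictionMap_tendsto
  exact ⟨quotientHull A A' Φ', hA.isStarHull_quotientHull hsub h0 hinf, hA, Φ', hΦ',
    hA.diff_eq_setOf_quotientHull hsub⟩

end IsStarHull

/-! ### `Φ'_A(0) = Φ'_B(0) Φ'_{A'}(0) ≤ Φ'_{A'}(0)` -/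

/-- From `A = B · A'`: the product hull built on `Φ_{A'}` is `A` itself. [folklore] -/
theorem RestrictionConfig.IsHullProduct.hullProduct_eq {B : Set ℂ} (hA' : IsStarHull A') (hB : IsStarHull B)
    (h : RestrictionConfig.IsHullProduct B A' A)
    {Φ' : ConformalEquiv (upperHalfPlaneSet \ A') upperHalfPlaneSet} (hΦ' : IsRestrictionMap A' Φ') :
    hullProduct B A' Φ' = A := by
  obtain ⟨hA, Φ'₁, hΦ'₁, hset⟩ := h
  refine (hB.hullProduct hA' hΦ').isBoundedHull.eq_of_diff_eq hA.isBoundedHull ?_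
  rw [diff_hullProduct hB.isBoundedHull.isClosed hA'.isBoundedHull.isClosed, hset]
  -- the two restriction maps of `A'` agree on `ℍ ∖ A'`
  obtain ⟨Φ₀, -, huniq⟩ := IsStarHull.existsUnique_isRestrictionMap_holds hA'
  ext z
  simp only [mem_setOf_eq]
  constructor
  · rintro ⟨hz, hzB⟩
    refine ⟨hz, ?_⟩
    rw [huniq Φ'₁ hΦ'₁ hz, ← huniq Φ' hΦ' hz]; exact hzB
  · rintro ⟨hz, hzB⟩
    refine ⟨hz, ?_⟩
    rw [huniq Φ' hΦ' hz, ← huniq Φ'₁ hΦ'₁ hz]; exact hzB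

/-- **Chain rule through `A = B · A'`**: `Φ'_A(0) = d_B · Φ'_{A'}(0)` for some `d_B = Φ'_B(0) ∈ (0, 1]`.
[cite: LawlerSchrammWerner2003Restriction, §2 (2.4) p. 7 with p. 8 (Semigroups)] -/
theorem HasRestrictionDeriv.exists_eq_mul_of_subset (hA : IsStarHull A) (hA' : IsStarHull A')
    (hsub : A' ⊆ A) {Φ : ConformalEquiv (upperHalfPlaneSet \ A) upperHalfPlaneSet}
    {Φ' : ConformalEquiv (upperHalfPlaneSet \ A') upperHalfPlaneSet} (hΦ : IsRestrictionMap A Φ)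
    (hΦ' : IsRestrictionMap A' Φ') {d d' : ℝ} (hd : HasRestrictionDeriv A Φ d)
    (hd' : HasRestrictionDeriv A' Φ' d') : ∃ dB : ℝ, 0 < dB ∧ dB ≤ 1 ∧ d = dB * d' := by
  obtain ⟨B, hB, hprod⟩ := hA.exists_isHullProduct_of_subset hA' hsub
  have hP : _root_.Literature.Probability.RandomPlanarGeometry.hullProduct B A' Φ' = A := hprod.hullProduct_eq hA' hB hΦ'
  -- the restriction map of `B` and its derivative
  obtain ⟨ΦB, hΦB, -⟩ := IsStarHull.existsUnique_isRestrictionMap_holds hB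
  obtain ⟨dB, hdB0, hdB1, hdB⟩ := IsStarHull.exists_hasRestrictionDeriv_holds hB hΦB
  refine ⟨dB, hdB0, hdB1, ?_⟩
  -- the product map `Φ_B ∘ Φ_{A'}` is a restriction map of `B · A' = A` with derivative `dB d'`
  have hBc := hB.isBoundedHull.isClosed
  have hA'c := hA'.isBoundedHull.isClosed
  have hPmap := hΦB.hullProduct hBc hA'c hΦ'
  have hPderiv := hdB.hullProduct hBc hA'c hΦ' hd'
  subst hP
  -- uniqueness of restriction maps of `A`, then of the number `Φ'_A(0)`
  obtain ⟨Φ₀, -, huniq⟩ := IsStarHull.existsUnique_isRestrictionMap_holds hA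
  have heq : EqOn Φ (hullProductMap ΦB Φ' hBc hA'c) (upperHalfPlaneSet \ _root_.Literature.Probability.RandomPlanarGeometry.hullProduct B A' Φ') :=
    fun z hz ↦ by rw [huniq Φ hΦ hz, huniq _ hPmap hz]
  have hd'' : HasRestrictionDeriv (_root_.Literature.Probability.RandomPlanarGeometry.hullProduct B A' Φ') Φ (dB * d') := by
    refine hPderiv.congr' ?_
    filter_upwards [self_mem_nhdsWithin] with z hz
    rw [heq hz]
  exact hd.unique hA hd''

/-- **Monotonicity of `Φ'_A(0)`**: `A' ⊆ A ⇒ Φ'_A(0) ≤ Φ'_{A'}(0)` for `*`-hulls (via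
`A = B · A'` and (2.4) for `B`). This is the monotonicity behind "the increasing sequence
`Φ'_{A_n}(0)`" of [LSW] Lemma 2.1. [cite: LawlerSchrammWerner2003Restriction, §2 (2.4) p. 7 with Lemma 2.1 (p. 8)] -/
theorem HasRestrictionDeriv.le_of_subset (hA : IsStarHull A) (hA' : IsStarHull A')
    (hsub : A' ⊆ A) {Φ : ConformalEquiv (upperHalfPlaneSet \ A) upperHalfPlaneSet}
    {Φ' : ConformalEquiv (upperHalfPlaneSet \ A') upperHalfPlaneSet} (hΦ : IsRestrictionMap A Φ)
    (hΦ' : IsRestrictionMap A' Φ') {d d' : ℝ} (hd : HasRestrictionDeriv A Φ d)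
    (hd' : HasRestrictionDeriv A' Φ' d') : d ≤ d' := by
  obtain ⟨dB, hdB0, hdB1, rfl⟩ := hd.exists_eq_mul_of_subset hA hA' hsub hΦ hΦ' hd'
  obtain ⟨d'', hd''0, -, hd''⟩ := IsStarHull.exists_hasRestrictionDeriv_holds hA' hΦ'
  have : d' = d'' := hd'.unique hA' hd''
  have hd'0 : 0 < d' := this ▸ hd''0
  nlinarith

end Literature.Probability.RandomPlanarGeometry
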